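import Summits.FinalStateConjecture.FinalStateConjecture.Theses.ZeroEnergyKerrOrBomb
import Literature.Geometry.Lorentzian.Stationary
import Literature.Geometry.Lorentzian.IPlusRegular
import Literature.Geometry.Lorentzian.Causality
import Literature.Geometry.Lorentzian.NonRotatingBlackHoleUniqueness
import Literature.Geometry.Lorentzian.AxisymmetricBlackHoleUniquenessProofs

/-!
# Sketch — crux-ideate `stmt-FinalStateConjecture-17840` (`HawkingExtensionIsKerr`), round 1, ideator 1

First lemmas of the crux idea cards (they must ELABORATE; no proof is claimed unless given).

* `LocallyTangentToHorizon` — the LOCAL form of the crux's tangency clause h13 (h13 quantifies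
  over whole-line integral curves of the raw section `K`, which is smooth on `U` only; every line
  needs the local form, see the cards' typing note).
* card `degenerate-collar-gauss-law`: `DegenerateCollarExcluded` (First lemma),
  `CollarSurfaceGravity` (the output both endgame branches consume),
  `NonRotatingBranchModFacts` (the non-rotating branch closes over the two registered facts
  WITHOUT the Hawking extension h15).
* card `completeness-by-conservation`: `FiniteSegmentsFlowBounded` (First lemma),
  `ExtensionComplete` (the line-level statement: the extended field `K'` is complete on the
  d.o.c.), and `gram_const_along` (PROVED: the tree's Gram-matrix conservation, the engine).
* card `unwrapped-collar-presentation`: `UnwrappedCollarPresentation` (First lemma = the docking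
  construction: a presentation with the same d.o.c. on which the extended field is global).
-/

noncomputable section

set_option linter.dupNamespace false

namespace Summit.FinalStateConjecture.FinalStateConjecture.Cruxes.HawkingExtensionIsKerr.Ideator1

open Set Literature.Geometry.Lorentzian
open scoped Manifold ContDiff Topology

/-- **Local tangency of `K` to `𝓔⁺`**: every integral curve of `K` on an open interval which
starts on the horizon stays on the horizon for the whole interval.  This is the form in which
tangency is USED (flow-invariance of `𝓔⁺` under the local flow of `K|_U`); the crux's clause h13
asserts it only for whole-line integral curves `γ : ℝ → M` of the raw section `K`. -/
def LocallyTangentToHorizon (𝓑 : StationaryAFBlackHole.{0})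
    (K : Π x : 𝓑.carrier, TangentSpace (𝓡 4) x) : Prop :=
  ∀ (γ : ℝ → 𝓑.carrier) (a b : ℝ), IsMIntegralCurveOn γ K (Set.Ioo a b) → (0 : ℝ) ∈ Set.Ioo a b →
    γ 0 ∈ 𝓑.horizon → ∀ t ∈ Set.Ioo a b, γ t ∈ 𝓑.horizon

/-! ## Card A — degenerate-collar-gauss-law -/

/-- **First lemma of card A: a degenerate horizon cannot wear a timelike VACUUM collar.**
Telescope of the crux up to h14 (vacuum, `I⁺`-regular, future-presented, simply connected d.o.c.,
connected horizon, `K` smooth Killing on an open `U ⊇ 𝓔⁺`, `[T, K] = 0` on `U`, `K ≠ 0` on `𝓔⁺`,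
`K` locally tangent to `𝓔⁺`, `K` timelike on `U ∩ doc`), plus `K` null on `𝓔⁺`: then `∇_K K`
cannot vanish identically on `𝓔⁺` (i.e. `κ ≡ 0` is impossible).  Mechanism: in Gaussian null
coordinates `g(K,K) = r² F(r,x)`; the collar gives `F(0,·) ≤ 0` on the compact section `H`, the
vacuum `(+−)` near-horizon equation gives `F = ½|h|² − ½ div h`, so `0 ≥ ∮_H F = ½∮_H |h|²`,
whence `h ≡ 0`, `F ≡ 0`, `Ric(γ_H) ≡ 0` — a flat metric on `H ≅ S²`, absurd. -/
def DegenerateCollarExcluded : Prop :=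
  ∀ (𝓑 : StationaryAFBlackHole.{0}) [𝓑.metric.HasLeviCivita],
    𝓑.metric.toPseudoRiemannianMetric.IsRicciFlat → 𝓑.IsIPlusRegular →
    (∀ p : 𝓑.carrier, p ∈ 𝓑.metric.chronologicalFuture 𝓑.timeOrientation 𝓑.Mext) →
    SimplyConnectedSpace 𝓑.doc →
    ∀ (U : Set 𝓑.carrier) (K : Π x : 𝓑.carrier, TangentSpace (𝓡 4) x),
      IsOpen U → 𝓑.horizon ⊆ U → IsConnected 𝓑.horizon →
      ContMDiffOn (𝓡 4) ((𝓡 4).prod 𝓘(ℝ, E4)) ((⊤ : ℕ∞) : WithTop ℕ∞)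
        (fun x ↦ (Bundle.TotalSpace.mk' E4 x (K x) : TangentBundle (𝓡 4) 𝓑.carrier)) U →
      (∀ x ∈ U, ∀ v w : TangentSpace (𝓡 4) x,
        𝓑.metric.val x (𝓑.metric.leviCivita K x v) w +
          𝓑.metric.val x v (𝓑.metric.leviCivita K x w) = 0) →
      (∀ x ∈ U, VectorField.mlieBracket (𝓡 4) 𝓑.killing K x = 0) →
      (∀ p ∈ 𝓑.horizon, K p ≠ 0) →
      LocallyTangentToHorizon 𝓑 K →
      (∀ x ∈ U ∩ 𝓑.doc, 𝓑.metric.val x (K x) (K x) < 0) →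
      (∀ p ∈ 𝓑.horizon, 𝓑.metric.val p (K p) (K p) = 0) →
      ¬ (∀ p ∈ 𝓑.horizon, 𝓑.metric.leviCivita K p (K p) = 0)

/-- **Output of card A (what both endgame branches consume): the collar field has ONE non-zero
surface gravity.**  Same telescope; conclusion: `K` is null on `𝓔⁺` and `∇_K K = κ K` on `𝓔⁺`
with a single constant `κ ≠ 0` (nullity from tangency + collar; `∇_K K ∥ K` since `𝓔⁺` is a
Killing horizon of `K|_U`; `κ` constant by the vacuum zeroth law on the connected `𝓔⁺`;
`κ ≠ 0` by `DegenerateCollarExcluded`).  This is exactly the horizon clause of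
`SudarskyWald1993_staticity` (with `K = c • T`) and of `IsNonDegenerateHorizon` (for the
re-presented hole of the rotating branch). -/
def CollarSurfaceGravity : Prop :=
  ∀ (𝓑 : StationaryAFBlackHole.{0}) [𝓑.metric.HasLeviCivita],
    𝓑.metric.toPseudoRiemannianMetric.IsRicciFlat → 𝓑.IsIPlusRegular →
    (∀ p : 𝓑.carrier, p ∈ 𝓑.metric.chronologicalFuture 𝓑.timeOrientation 𝓑.Mext) →
    SimplyConnectedSpace 𝓑.doc →
    ∀ (U : Set 𝓑.carrier) (K : Π x : 𝓑.carrier, TangentSpace (𝓡 4) x),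
      IsOpen U → 𝓑.horizon ⊆ U → IsConnected 𝓑.horizon →
      ContMDiffOn (𝓡 4) ((𝓡 4).prod 𝓘(ℝ, E4)) ((⊤ : ℕ∞) : WithTop ℕ∞)
        (fun x ↦ (Bundle.TotalSpace.mk' E4 x (K x) : TangentBundle (𝓡 4) 𝓑.carrier)) U →
      (∀ x ∈ U, ∀ v w : TangentSpace (𝓡 4) x,
        𝓑.metric.val x (𝓑.metric.leviCivita K x v) w +
          𝓑.metric.val x v (𝓑.metric.leviCivita K x w) = 0) →
      (∀ x ∈ U, VectorField.mlieBracket (𝓡 4) 𝓑.killing K x = 0) →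
      (∀ p ∈ 𝓑.horizon, K p ≠ 0) →
      LocallyTangentToHorizon 𝓑 K →
      (∀ x ∈ U ∩ 𝓑.doc, 𝓑.metric.val x (K x) (K x) < 0) →
      (∀ p ∈ 𝓑.horizon, 𝓑.metric.val p (K p) (K p) = 0) ∧
        ∃ κ : ℝ, κ ≠ 0 ∧ ∀ p ∈ 𝓑.horizon, 𝓑.metric.leviCivita K p (K p) = κ • K p

/-- **The non-rotating branch closes over the two REGISTERED facts, without the Hawking
extension h15.**  If the collar field is parallel to `T` along `𝓔⁺`, then (card A with `K ↦ T`
after the constant-ratio step) `T` itself satisfies the horizon clause of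
`SudarskyWald1993_staticity`; staticity of the d.o.c. and `ChruscielGalloway2010_docStaticUniqueness`
give the Schwarzschild exterior, and the landed transfer (`NonRotatingUniqueness` /
`KerrChartTransfer`, p89982 pattern) the Kerr chart with `a = 0`.  Stated modulo the two named
facts (hypotheses), as the line's branch lemma. -/
def NonRotatingBranchModFacts : Prop :=
  SudarskyWald1993_staticity → ChruscielGalloway2010_docStaticUniqueness →
  ∀ (𝓑 : StationaryAFBlackHole.{0}) [𝓑.metric.HasLeviCivita] [Kerr.Facts],
    𝓑.metric.toPseudoRiemannianMetric.IsRicciFlat → 𝓑.IsIPlusRegular →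
    (∀ p : 𝓑.carrier, p ∈ 𝓑.metric.chronologicalFuture 𝓑.timeOrientation 𝓑.Mext) →
    SimplyConnectedSpace 𝓑.doc →
    ∀ (U : Set 𝓑.carrier) (K : Π x : 𝓑.carrier, TangentSpace (𝓡 4) x),
      IsOpen U → 𝓑.horizon ⊆ U → IsConnected 𝓑.horizon →
      ContMDiffOn (𝓡 4) ((𝓡 4).prod 𝓘(ℝ, E4)) ((⊤ : ℕ∞) : WithTop ℕ∞)
        (fun x ↦ (Bundle.TotalSpace.mk' E4 x (K x) : TangentBundle (𝓡 4) 𝓑.carrier)) U →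
      (∀ x ∈ U, ∀ v w : TangentSpace (𝓡 4) x,
        𝓑.metric.val x (𝓑.metric.leviCivita K x v) w +
          𝓑.metric.val x v (𝓑.metric.leviCivita K x w) = 0) →
      (∀ x ∈ U, VectorField.mlieBracket (𝓡 4) 𝓑.killing K x = 0) →
      (∀ p ∈ 𝓑.horizon, K p ≠ 0) →
      LocallyTangentToHorizon 𝓑 K →
      (∀ x ∈ U ∩ 𝓑.doc, 𝓑.metric.val x (K x) (K x) < 0) →
      (∀ p ∈ 𝓑.horizon, ∃ c : ℝ, 𝓑.killing p = c • K p) →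
      ∃ (M a : ℝ), Kerr.IsSubextremal M a ∧ ∃ Ψ : Kerr.exterior M a → 𝓑.carrier,
        Function.Injective Ψ ∧ Set.range Ψ = 𝓑.doc ∧
          PseudoRiemannianMetric.IsIsometricImmersion
            (Kerr.smoothMetric M a (Kerr.rPlus M a)).toPseudoRiemannianMetric
            𝓑.metric.toPseudoRiemannianMetric Ψ

/-! ## Card B — completeness-by-conservation -/

/-- **First lemma of card B: finite-time orbit segments of the extended field are flow-bounded.**
For any `K'` smooth and Killing on the d.o.c. with `[T, K'] = 0` there, an integral curve of `K'`
on `[0, b)` lying in the d.o.c. stays inside the `T`-orbit of a compact subset of the d.o.c.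
together with the prescribed horizon neighbourhood `U'`.  Mechanism: the Gram scalars
`g(K',K'), g(K',T), g(T,T)` are constant along the curve (`gram_const_along`), so the curve never
changes the causal type of `T`; where `T` is timelike (in particular on `M_ext`) the
`T`-orthogonal speed `g(K',K') − g(K',T)²/g(T,T)` is constant and dominates `|d(r ∘ γ)/dt|` on
the AF end, so the radius stays bounded on `[0, b)`; and `doc = ⋃ₜ φₜ(S)` for the `I⁺`-regular
hypersurface `S`, whose closure is compact modulo the end with `∂S̄ ⊆ 𝓔⁺ ⊆ U'`. -/
def FiniteSegmentsFlowBounded : Prop :=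
  ∀ (𝓑 : StationaryAFBlackHole.{0}) [𝓑.metric.HasLeviCivita],
    𝓑.IsIPlusRegular →
    (∀ p : 𝓑.carrier, p ∈ 𝓑.metric.chronologicalFuture 𝓑.timeOrientation 𝓑.Mext) →
    ∀ (K' : Π x : 𝓑.carrier, TangentSpace (𝓡 4) x) (U' : Set 𝓑.carrier),
      IsOpen U' → 𝓑.horizon ⊆ U' →
      ContMDiffOn (𝓡 4) ((𝓡 4).prod 𝓘(ℝ, E4)) ((⊤ : ℕ∞) : WithTop ℕ∞)
        (fun x ↦ (Bundle.TotalSpace.mk' E4 x (K' x) : TangentBundle (𝓡 4) 𝓑.carrier)) 𝓑.doc →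
      (∀ x ∈ 𝓑.doc, ∀ v w : TangentSpace (𝓡 4) x,
        𝓑.metric.val x (𝓑.metric.leviCivita K' x v) w +
          𝓑.metric.val x v (𝓑.metric.leviCivita K' x w) = 0) →
      (∀ x ∈ 𝓑.doc, VectorField.mlieBracket (𝓡 4) 𝓑.killing K' x = 0) →
      ∀ (γ : ℝ → 𝓑.carrier) (b : ℝ), 0 < b → IsMIntegralCurveOn γ K' (Set.Ico 0 b) →
        (∀ t ∈ Set.Ico 0 b, γ t ∈ 𝓑.doc) →
        ∃ C : Set 𝓑.carrier, IsCompact C ∧ C ⊆ 𝓑.doc ∧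
          ∀ t ∈ Set.Ico 0 b, γ t ∈ stationaryOrbit 𝓑.killing (C ∪ U')

/-- **Line-level statement of card B: the Hawking extension is complete on the d.o.c.**
In the telescope (only `I⁺`-regularity, future-presentedness and the collar's smoothness /
local tangency are used), every `K'` smooth and Killing on the d.o.c., commuting with `T` and
equal to the collar field near `𝓔⁺`, has complete integral curves inside the d.o.c.
(`FiniteSegmentsFlowBounded` + uniform lifetime on `T · C` by `T`-invariance of `K'` + uniform
lifetime near the compact cross-section `∂S̄ ⊆ 𝓔⁺` by smoothness of `K` on `U` and local
flow-invariance of the d.o.c.).  Replaces Chruściel 1993 Thm 1.1 (needs the d.o.c. to be a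
maximal development) and the Beig–Chruściel 1996 asymptotics of Killing vectors. -/
def ExtensionComplete : Prop :=
  ∀ (𝓑 : StationaryAFBlackHole.{0}) [𝓑.metric.HasLeviCivita],
    𝓑.IsIPlusRegular →
    (∀ p : 𝓑.carrier, p ∈ 𝓑.metric.chronologicalFuture 𝓑.timeOrientation 𝓑.Mext) →
    ∀ (U : Set 𝓑.carrier) (K : Π x : 𝓑.carrier, TangentSpace (𝓡 4) x),
      IsOpen U → 𝓑.horizon ⊆ U → IsConnected 𝓑.horizon →
      ContMDiffOn (𝓡 4) ((𝓡 4).prod 𝓘(ℝ, E4)) ((⊤ : ℕ∞) : WithTop ℕ∞)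
        (fun x ↦ (Bundle.TotalSpace.mk' E4 x (K x) : TangentBundle (𝓡 4) 𝓑.carrier)) U →
      (∀ p ∈ 𝓑.horizon, K p ≠ 0) →
      LocallyTangentToHorizon 𝓑 K →
      ∀ (K' : Π x : 𝓑.carrier, TangentSpace (𝓡 4) x),
        ContMDiffOn (𝓡 4) ((𝓡 4).prod 𝓘(ℝ, E4)) ((⊤ : ℕ∞) : WithTop ℕ∞)
          (fun x ↦ (Bundle.TotalSpace.mk' E4 x (K' x) : TangentBundle (𝓡 4) 𝓑.carrier)) 𝓑.doc →
        (∀ x ∈ 𝓑.doc, ∀ v w : TangentSpace (𝓡 4) x,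
          𝓑.metric.val x (𝓑.metric.leviCivita K' x v) w +
            𝓑.metric.val x v (𝓑.metric.leviCivita K' x w) = 0) →
        (∀ x ∈ 𝓑.doc, VectorField.mlieBracket (𝓡 4) 𝓑.killing K' x = 0) →
        (∃ U' : Set 𝓑.carrier, IsOpen U' ∧ 𝓑.horizon ⊆ U' ∧ ∀ x ∈ U' ∩ 𝓑.doc, K' x = K x) →
        ∀ x ∈ 𝓑.doc, ∃ γ : ℝ → 𝓑.carrier, γ 0 = x ∧ IsMIntegralCurve γ K' ∧ ∀ t, γ t ∈ 𝓑.doc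

/-! ## Card C — unwrapped-collar-presentation -/

/-- **First lemma of card C (the docking construction): the UNWRAPPED-COLLAR presentation.**
Pull the geometry back along the flow-out map `Φ(t, b) = φₜ(b)` of a small slab `B₀` through one
compact cross-section of `𝓔⁺`: upstairs, on `ℝ × B₀`, `Φ^*g` is `t`-invariant for free (`T` is
Killing and complete), the `t`-invariant transport `K̃` of `K|_{B₀}` is Killing EVERYWHERE (it is
so on `{|t| < σ₀} × B₀` and both `Φ^*g`, `K̃` are `t`-invariant), `Φ^*g` is Ricci-flat, and the
shape of `U` and the dynamics of `T` inside the black hole never enter (non-injectivity of `Φ` on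
the interior side is irrelevant; on the d.o.c. side `Φ` is injective by the `I⁺`-regular structure,
and there `K̃ = Φ^*K'` by `T`-invariance of `K'`).  Gluing the `(∂ₜ, K̃)`-saturated tube to the
d.o.c. along the injective side gives a presentation `𝓑'` with the SAME d.o.c., on which the
extended field is GLOBAL, complete and commutes with `T` — i.e. the hypotheses of the landed
regular-case endgame (`RegularCase.stub_kerrConclusion_of_regular`, p89982) and of the vendored
`ChruscielCostaHeusler2012_axisymmetricUniqueness`, together with an isometric immersion
`ι : 𝓑' → 𝓑` which is injective on `𝓑'.doc` with image `𝓑.doc` (the transfer datum of the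
landed `DocIsometryTransfer`, S5 pattern).  Inputs: the telescope, local tangency, the surface
gravity clause (card A) and completeness of `K'` on the d.o.c. (card B). -/
def UnwrappedCollarPresentation : Prop :=
  ∀ (𝓑 : StationaryAFBlackHole.{0}) [𝓑.metric.HasLeviCivita],
    𝓑.metric.toPseudoRiemannianMetric.IsRicciFlat → 𝓑.IsIPlusRegular →
    (∀ p : 𝓑.carrier, p ∈ 𝓑.metric.chronologicalFuture 𝓑.timeOrientation 𝓑.Mext) →
    ∀ (U : Set 𝓑.carrier) (K : Π x : 𝓑.carrier, TangentSpace (𝓡 4) x),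
      IsOpen U → 𝓑.horizon ⊆ U → IsConnected 𝓑.horizon →
      ContMDiffOn (𝓡 4) ((𝓡 4).prod 𝓘(ℝ, E4)) ((⊤ : ℕ∞) : WithTop ℕ∞)
        (fun x ↦ (Bundle.TotalSpace.mk' E4 x (K x) : TangentBundle (𝓡 4) 𝓑.carrier)) U →
      (∀ x ∈ U, ∀ v w : TangentSpace (𝓡 4) x,
        𝓑.metric.val x (𝓑.metric.leviCivita K x v) w +
          𝓑.metric.val x v (𝓑.metric.leviCivita K x w) = 0) →
      (∀ x ∈ U, VectorField.mlieBracket (𝓡 4) 𝓑.killing K x = 0) →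
      (∀ p ∈ 𝓑.horizon, K p ≠ 0) →
      LocallyTangentToHorizon 𝓑 K →
      (∃ κ : ℝ, κ ≠ 0 ∧ ∀ p ∈ 𝓑.horizon, 𝓑.metric.leviCivita K p (K p) = κ • K p) →
      ∀ (K' : Π x : 𝓑.carrier, TangentSpace (𝓡 4) x),
        ContMDiffOn (𝓡 4) ((𝓡 4).prod 𝓘(ℝ, E4)) ((⊤ : ℕ∞) : WithTop ℕ∞)
          (fun x ↦ (Bundle.TotalSpace.mk' E4 x (K' x) : TangentBundle (𝓡 4) 𝓑.carrier)) 𝓑.doc →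
        (∀ x ∈ 𝓑.doc, ∀ v w : TangentSpace (𝓡 4) x,
          𝓑.metric.val x (𝓑.metric.leviCivita K' x v) w +
            𝓑.metric.val x v (𝓑.metric.leviCivita K' x w) = 0) →
        (∀ x ∈ 𝓑.doc, VectorField.mlieBracket (𝓡 4) 𝓑.killing K' x = 0) →
        (∃ U' : Set 𝓑.carrier, IsOpen U' ∧ 𝓑.horizon ⊆ U' ∧ ∀ x ∈ U' ∩ 𝓑.doc, K' x = K x) →
        (∀ x ∈ 𝓑.doc, ∃ γ : ℝ → 𝓑.carrier, γ 0 = x ∧ IsMIntegralCurve γ K' ∧ ∀ t, γ t ∈ 𝓑.doc) →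
        ∃ (𝓑' : StationaryAFBlackHole.{0}) (_ : 𝓑'.metric.HasLeviCivita)
          (ι : 𝓑'.carrier → 𝓑.carrier) (K₁ : Π y : 𝓑'.carrier, TangentSpace (𝓡 4) y),
          𝓑'.metric.toPseudoRiemannianMetric.IsRicciFlat ∧ 𝓑'.IsIPlusRegular ∧
          IsConnected 𝓑'.horizon ∧
          𝓑'.metric.IsKillingField K₁ ∧ IsCompleteVectorField K₁ ∧
          (∀ y, VectorField.mlieBracket (𝓡 4) 𝓑'.killing K₁ y = 0) ∧
          (∀ q ∈ 𝓑'.horizon, K₁ q ≠ 0) ∧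
          (∀ γ : ℝ → 𝓑'.carrier, IsMIntegralCurve γ K₁ → γ 0 ∈ 𝓑'.horizon →
            ∀ t, γ t ∈ 𝓑'.horizon) ∧
          (∃ κ : ℝ, κ ≠ 0 ∧ ∀ q ∈ 𝓑'.horizon, 𝓑'.metric.leviCivita K₁ q (K₁ q) = κ • K₁ q) ∧
          ContMDiff (𝓡 4) (𝓡 4) ((⊤ : ℕ∞) : WithTop ℕ∞) ι ∧
          PseudoRiemannianMetric.IsIsometricImmersion 𝓑'.metric.toPseudoRiemannianMetric
            𝓑.metric.toPseudoRiemannianMetric ι ∧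
          Set.InjOn ι 𝓑'.doc ∧ ι '' 𝓑'.doc = 𝓑.doc ∧ ι '' 𝓑'.horizon = 𝓑.horizon ∧
          (∀ y ∈ 𝓑'.doc, mfderiv (𝓡 4) (𝓡 4) ι y (K₁ y) = K' (ι y) ∧
            mfderiv (𝓡 4) (𝓡 4) ι y (𝓑'.killing y) = 𝓑.killing (ι y))

/-- **The engine of card B, PROVED from the tree (carrier-level form): the Gram matrix of two
commuting Killing fields is constant along the integral curves of either.**  For `T`, `Y` Killing
with `[T, Y] = 0` and `γ` an integral curve of `Y`, the three scalars `g(T,T)`, `g(T,Y)`, `g(Y,Y)`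
agree at `γ s` and `γ t`.  (Tree: the four `mvfderiv_val_…_of_mlieBracket_eq_zero` identities and
`apply_eq_apply_of_isMIntegralCurve_of_mvfderiv_eq_zero`, `AxisymmetricBlackHoleUniquenessProofs`;
the doc-local form for the crux's `K'` follows by restriction to the open sub-spacetime `doc`,
`DocStationarySpacetime.isKillingField_congr_metric`.) -/
theorem gram_const_along (𝓑 : StationaryAFBlackHole.{0}) [𝓑.metric.HasLeviCivita]
    (Y : Π x : 𝓑.carrier, TangentSpace (𝓡 4) x) (hY : 𝓑.metric.IsKillingField Y)
    (hTY : ∀ x, VectorField.mlieBracket (𝓡 4) 𝓑.killing Y x = 0) {γ : ℝ → 𝓑.carrier}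
    (hγ : IsMIntegralCurve γ Y) (s t : ℝ) :
    𝓑.metric.val (γ s) (𝓑.killing (γ s)) (𝓑.killing (γ s)) =
        𝓑.metric.val (γ t) (𝓑.killing (γ t)) (𝓑.killing (γ t)) ∧
      𝓑.metric.val (γ s) (𝓑.killing (γ s)) (Y (γ s)) =
        𝓑.metric.val (γ t) (𝓑.killing (γ t)) (Y (γ t)) ∧
      𝓑.metric.val (γ s) (Y (γ s)) (Y (γ s)) = 𝓑.metric.val (γ t) (Y (γ t)) (Y (γ t)) := by
  have hT : 𝓑.metric.IsKillingField 𝓑.killing := 𝓑.isStationaryKilling.isKillingField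
  exact hT.gram_apply_eq_of_isMIntegralCurve_right hY hTY hγ s t

end Summit.FinalStateConjecture.FinalStateConjecture.Cruxes.HawkingExtensionIsKerr.Ideator1

end
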